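import Summits.RiemannHypothesis.RiemannHypothesis.Theorems.WeilFormatCCinfGramRange
import Summits.RiemannHypothesis.RiemannHypothesis.Theorems.WeilFormatCCinfTrigTagTables
import Summits.RiemannHypothesis.RiemannHypothesis.Theorems.WeilFormatCCinfHankelCheck
import Literature.NumberTheory.LFunctions.YoshidaWindowGramFrontDoor
import HarnessLib

/-!
# Format C, design C∞ (E2c, data side): HANKEL ENTRIES from the format-C records — range part, crude tails, per-pair checker, assembly

Route context: Fourier–Galerkin / Schur-complement certificates of Weil positivity on a window ("format C", C∞ door
`weilPositivityOn_of_cinf_pipeline`; supporting stmt-RiemannHypothesis-0098; seat rh-explicit-weil-2, cell memos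
`run/shared/lean/pub/rh-explicit/rh-explicit-weil-2/gen15/E2-PLAN-v2.md` §6 and gen18 NOTES (Hankel sweeps j239044/j239104)).

The pipeline door wants, for the tag family `T = (1, log m, −C_m, S_m)` (`C_m, S_m` the prime cosine/sine sums at frequency `πm/a`),
boxes of the Hankel tail sums `X t t' s = Σ'_k T_t(m₀+k) T_t'(m₀+k) (m₀/(m₀+k))^s`, `2 ≤ s ≤ 2D` (`hHe/hHo`).  This file supplies the
generic, sector-independent pieces of a RANGE + FAR evaluator whose tags are READ FROM THE CERTIFIED SPECIAL-VALUE RECORDS of a format-C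
rung (`Encl.IdxRec.cs ∋ e^{iω_m ℓ_q}`, `Encl.TabColValid`), so that no separate trigonometric tag tables are needed:

* `CinfHankelR.tagT` — the door's tag family, verbatim; `cosSum`/`mem_cosSum` (cosine twin of `Encl.sinSum`);
* `tagBox`/★`mem_tagBox` — the four tag boxes at a mode from its record (+ `CinfCoeff.logTag`), `rangeBox`/★`mem_rangeBox` — the exact
  range `Σ_{m∈[m₀,m₀+L)}` over a light table (`CinfCoeff.mem_rangeEntryBox`);
* `symBox`/`mem_symBox_of_abs_le` — a crude symmetric box from an absolute bound (for majorised far tails);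
* ★ `mem_entry` — range box + ANY far-tail box `∋ Σ'_k (… at m₀+L+k)` gives a box of `X t t' s` (`CinfCoeff.mem_add_of_range_far`;
  tag square-summability as a hypothesis, supplied by `cinf_tags_summable`);
* `checkBand`/★`abs_sub_mid_le_of_checkBand` — kernel check of a band of `s` for ONE pair against a claimed table stored at a COARSER
  scale `S'` (`S = S'·2^sh`), giving `|X s − mid| ≤ rad` with `mid/rad` read at `S'`; ★ `hankel_of_pairs` — the door's `hH` and `hsym`
  (with `CinfCoeff.tabMid/tabRad`) from the ten pairs `t ≤ t'`, a tag-symmetric claimed table and the symmetry of `X`.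

Interval bookkeeping over landed evaluators; standard axioms; no RH claim.
-/

set_option autoImplicit false
-- `Summit.RiemannHypothesis.RiemannHypothesis.…` is the layout-mandated namespace (summit = problem name).
set_option linter.dupNamespace false

open Finset
open scoped Real ArithmeticFunction.vonMangoldt

namespace Summit.RiemannHypothesis.RiemannHypothesis.Theorems.WeilFormatC

namespace CinfHankelR

open Literature.NumberTheory.LFunctions Literature.NumberTheory.LFunctions.Yoshida1992 Literature.Analysis.SpecialFunctions
open Literature.Analysis.ValidatedNumerics Literature.Analysis.ValidatedNumerics.NumericsMP
open Encl (Consts ConstsValid IdxRec OffValid ColValid TabColValid tget sinSum mem_sinSum)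
open CinfCoeff (logTag logTagsOK mem_logTag rangeEntryBox mem_rangeEntryBox mem_add_of_range_far summable_hankel_term tabMid tabRad)

variable {S : ℕ} {a : ℝ} {ks : List PrimeLen} {C : Consts}

/-! ## The tag family -/

/-- **The door's tag family** `T = (1, log m, −C_m, S_m)` (verbatim the lambda of `weilPositivityOn_of_cinf_pipeline`'s `hHe/hHo`). -/
noncomputable def tagT (a : ℝ) : Fin 4 → ℕ → ℝ :=
  fun (t : Fin 4) (m : ℕ) ↦ ![(1 : ℝ), Real.log m,
    -(∑ n ∈ weilPrimeIndex a, (Λ n : ℝ) / Real.sqrt n * Real.cos (π * m / a * Real.log n)),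
    (∑ n ∈ weilPrimeIndex a, (Λ n : ℝ) / Real.sqrt n * Real.sin (π * m / a * Real.log n))] t

/-- The Hankel tail sum of the pair `(t, t')` at power `s` from the mode `m₀`. -/
noncomputable def X (a : ℝ) (m₀ : ℕ) (t t' : Fin 4) (s : ℕ) : ℝ :=
  ∑' k : ℕ, tagT a t (m₀ + k) * tagT a t' (m₀ + k) * ((m₀ : ℝ) / ((m₀ + k : ℕ) : ℝ)) ^ s

/-- `X` is symmetric in the tags. -/
theorem X_symm (a : ℝ) (m₀ : ℕ) (t t' : Fin 4) (s : ℕ) : X a m₀ t t' s = X a m₀ t' t s := by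
  unfold X; congr 1; funext k; ring

/-! ## Prime cosine sums from the record phases -/

/-- `Σ_{i<k} wts_i · Re cs_i` (the prime cosine sum at one mode; twin of `Encl.sinSum`). -/
def cosSum (S : ℕ) (wts : List MI) (cs : List MC) : ℕ → MI
  | 0 => MI.ofInt S 0
  | i + 1 => (cosSum S wts cs i).add ((wts.getD i default).mul S (cs.getD i default).re)

/-- `cosSum ∋ Σ_{i<k} wt_i cos(ω_n ℓ_i)`. -/
theorem mem_cosSum (hS : 0 < S) (hC : ConstsValid S a ks C) {n : ℤ} {R : IdxRec} (hR : OffValid S a ks n R) :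
    ∀ k, k ≤ ks.length → MI.mem S (∑ i ∈ Finset.range k, (ks.getD i default).wt *
      Real.cos (freq a n * (ks.getD i default).len)) (cosSum S C.wts R.cs k)
  | 0, _ => by simpa [cosSum] using MI.mem_ofInt S 0
  | k + 1, hk => by
      rw [Finset.sum_range_succ, cosSum]
      have hk' : k < ks.length := hk
      have hcs : MI.mem S (Real.cos (freq a n * (ks.getD k default).len)) (R.cs.getD k default).re := by
        have := (hR.cs k hk').1
        rwa [Complex.exp_ofReal_mul_I_re] at this
      exact MI.mem_add (mem_cosSum hS hC hR k (by omega)) (MI.mem_mul hS (hC.wts k hk') hcs)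

/-- The prime cosine sum at a natural mode, in the door's spelling. -/
theorem cos_sum_eq (hks : PrimeData a ks) (m : ℕ) :
    (∑ n ∈ weilPrimeIndex a, (Λ n : ℝ) / Real.sqrt n * Real.cos (π * m / a * Real.log n))
      = ∑ i ∈ Finset.range ks.length, (ks.getD i default).wt * Real.cos (freq a m * (ks.getD i default).len) := by
  rw [Encl.sum_weilPrimeIndex_eq_listSum hks, Encl.list_sum_map_eq_sum_range]
  refine Finset.sum_congr rfl fun i _ ↦ ?_
  rw [PrimeLen.log_val, freq]; push_cast; ring_nf

/-- The prime sine sum at a natural mode, in the door's spelling. -/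
theorem sin_sum_eq (hks : PrimeData a ks) (m : ℕ) :
    (∑ n ∈ weilPrimeIndex a, (Λ n : ℝ) / Real.sqrt n * Real.sin (π * m / a * Real.log n))
      = ∑ i ∈ Finset.range ks.length, (ks.getD i default).wt * Real.sin (freq a m * (ks.getD i default).len) := by
  rw [Encl.sum_weilPrimeIndex_eq_listSum hks, Encl.list_sum_map_eq_sum_range]
  refine Finset.sum_congr rfl fun i _ ↦ ?_
  rw [PrimeLen.log_val, freq]; push_cast; ring_nf

/-! ## Tag boxes from a record -/

/-- **Tag boxes at the mode `m`** from its record `R` (`t = 0,1,2,3`; the `log` tag by `CinfCoeff.logTag` with `K` series terms). -/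
def tagBox (S K : ℕ) (C : Consts) (R : IdxRec) (m : ℕ) (t : ℕ) : MI :=
  if t = 0 then WinConst.ratBox S 1
  else if t = 1 then logTag S K m
  else if t = 2 then (cosSum S C.wts R.cs C.wts.length).neg
  else sinSum S C.wts R.cs C.wts.length

/-- ★ `tagBox ∋ tagT a t m` for a record valid at `m` (and a valid `log` box). -/
theorem mem_tagBox (hS : 0 < S) (hks : PrimeData a ks) (hC : ConstsValid S a ks C) {m : ℕ} {R : IdxRec}
    (hR : OffValid S a ks (m : ℤ) R) {K : ℕ} (hlog : MI.mem S (Real.log (m : ℝ)) (logTag S K m)) (t : Fin 4) :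
    MI.mem S (tagT a t m) (tagBox S K C R m t) := by
  have hc := mem_cosSum hS hC hR ks.length le_rfl
  have hs := mem_sinSum hS hC hR ks.length le_rfl
  rw [← hC.wts_len] at hc hs
  fin_cases t
  · simpa [tagT, tagBox] using WinConst.mem_ratBox S 1
  · simpa [tagT, tagBox] using hlog
  · simp only [tagT, tagBox]
    rw [cos_sum_eq hks m, ← hC.wts_len]
    simpa using MI.mem_neg hc
  · simp only [tagT, tagBox]
    rw [sin_sum_eq hks m, ← hC.wts_len]
    simpa using hs

/-! ## The exact range over a light table -/

/-- **Range box** `Σ_{m ∈ [m₀, m₀+L)} T_t T_t' (m₀/m)^s` over the records `tget ctab m`. -/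
def rangeBox (S K : ℕ) (C : Consts) (ctab : List IdxRec) (m₀ L t t' s : ℕ) : MI :=
  rangeEntryBox S (fun i ↦ tagBox S K C (tget ctab (m₀ + i)) (m₀ + i) t) (fun i ↦ tagBox S K C (tget ctab (m₀ + i)) (m₀ + i) t')
    m₀ L s

/-- ★ `rangeBox ∋` the exact range, from a light table valid on `[lo, hi) ⊇ [m₀, m₀+L)` and the `log` guard. -/
theorem mem_rangeBox (hS : 0 < S) (hks : PrimeData a ks) (hC : ConstsValid S a ks C) {ctab : List IdxRec} {lo hi : ℕ}
    (hCT : TabColValid S a ks lo hi ctab) {m₀ L K : ℕ} (hlo : lo ≤ m₀) (hhi : m₀ + L ≤ hi)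
    (hlog : logTagsOK S K m₀ L = true) (t t' : Fin 4) (s : ℕ) :
    MI.mem S (∑ m ∈ Finset.Ico m₀ (m₀ + L), tagT a t m * tagT a t' m * ((m₀ : ℝ) / (m : ℝ)) ^ s)
      (rangeBox S K C ctab m₀ L t t' s) := by
  have hrec : ∀ i < L, OffValid S a ks ((m₀ + i : ℕ) : ℤ) (tget ctab (m₀ + i)) :=
    fun i hi ↦ (hCT (m₀ + i) (by omega) (by omega)).1
  exact mem_rangeEntryBox hS (T := tagT a t) (T' := tagT a t')
    (fun i hi ↦ mem_tagBox hS hks hC (hrec i hi) (mem_logTag hS hlog i hi) t)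
    (fun i hi ↦ mem_tagBox hS hks hC (hrec i hi) (mem_logTag hS hlog i hi) t') s

/-! ## Crude symmetric boxes -/

/-- The symmetric box `[−Y.hi, Y.hi]`. -/
def symBox (Y : MI) : MI := ⟨-Y.hi, Y.hi⟩

/-- `|x| ≤ y`, `Y ∋ y` ⇒ `symBox Y ∋ x`. -/
theorem mem_symBox_of_abs_le {x y : ℝ} (h : |x| ≤ y) {Y : MI} (hy : MI.mem S y Y) : MI.mem S x (symBox Y) := by
  have hS0 : (0 : ℝ) ≤ S := by exact_mod_cast Nat.zero_le S
  have h2 : y * S ≤ (Y.hi : ℝ) := hy.2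
  have hxy : |x| * S ≤ y * S := mul_le_mul_of_nonneg_right h hS0
  rw [abs_mul_eq_abs_of_nonneg hS0] at hxy
  refine ⟨?_, ?_⟩ <;> simp only [symBox, Int.cast_neg] <;>
    [linarith [neg_abs_le (x * S)]; linarith [le_abs_self (x * S)]]
  where
  abs_mul_eq_abs_of_nonneg {u v : ℝ} (hv : 0 ≤ v) : |u| * v = |u * v| := by rw [abs_mul, abs_of_nonneg hv]

/-! ## Entry = range + far -/

/-- ★ **An entry box**: the range box plus ANY box of the far tail from `m₀ + L` encloses `X t t' s` (`2 ≤ s`, `1 ≤ m₀`; tag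
square-summability from `cinf_tags_summable`). -/
theorem mem_entry {m₀ L : ℕ} (hm₀ : 1 ≤ m₀)
    (hT : ∀ t : Fin 4, Summable fun k : ℕ ↦ tagT a t (m₀ + k) ^ 2 / ((m₀ + k : ℕ) : ℝ) ^ 2)
    {t t' : Fin 4} {s : ℕ} (hs : 2 ≤ s) {Rg F : MI}
    (hRg : MI.mem S (∑ m ∈ Finset.Ico m₀ (m₀ + L), tagT a t m * tagT a t' m * ((m₀ : ℝ) / (m : ℝ)) ^ s) Rg)
    (hF : MI.mem S (∑' k : ℕ, tagT a t (m₀ + L + k) * tagT a t' (m₀ + L + k) * ((m₀ : ℝ) / ((m₀ + L + k : ℕ) : ℝ)) ^ s) F) :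
    MI.mem S (X a m₀ t t' s) (Rg.add F) := by
  unfold X
  exact mem_add_of_range_far (h := fun m : ℕ ↦ tagT a t m * tagT a t' m * ((m₀ : ℝ) / (m : ℝ)) ^ s)
    (summable_hankel_term hm₀ (hT t) (hT t') hs) hRg hF

/-! ## Per-pair band check against a claimed table at a coarser scale -/

/-- **Band check** for one pair: for `s0 ≤ s < s0 + n`, the evaluator box `E s` (scale `S'·2^sh`) lies inside the claimed box
`tab s` (scale `S'`) rescaled by `2^sh`. -/
def checkBand (E tab : ℕ → MI) (sh s0 n : ℕ) : Bool :=
  (List.range n).all fun i ↦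
    decide ((tab (s0 + i)).lo * 2 ^ sh ≤ (E (s0 + i)).lo) && decide ((E (s0 + i)).hi ≤ (tab (s0 + i)).hi * 2 ^ sh)

/-- ★ **Soundness of `checkBand`**: memberships in `E` at the fine scale give `|X s − mid| ≤ rad` with `mid`, `rad` read off the
claimed table at the coarse scale `S'`. -/
theorem abs_sub_mid_le_of_checkBand {S' sh : ℕ} (hS' : 0 < S') {Xs : ℕ → ℝ} {E tab : ℕ → MI} {s0 n : ℕ}
    (hE : ∀ s, s0 ≤ s → s < s0 + n → MI.mem (S' * 2 ^ sh) (Xs s) (E s)) (h : checkBand E tab sh s0 n = true) :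
    ∀ s, s0 ≤ s → s < s0 + n →
      |Xs s - (((tab s).lo : ℝ) + (tab s).hi) / (2 * S')| ≤ (((tab s).hi : ℝ) - (tab s).lo) / (2 * S') := by
  intro s hs1 hs2
  unfold checkBand at h
  rw [List.all_eq_true] at h
  have hi := h (s - s0) (List.mem_range.2 (by omega))
  rw [show s0 + (s - s0) = s by omega, Bool.and_eq_true, decide_eq_true_eq, decide_eq_true_eq] at hi
  obtain ⟨hlo, hhi⟩ := hi
  have hm := hE s hs1 hs2
  have hS'r : (0 : ℝ) < S' := by exact_mod_cast hS'
  have hpow : (0 : ℝ) < (2 : ℝ) ^ sh := by positivity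
  have h1 : ((E s).lo : ℝ) ≤ Xs s * ((S' * 2 ^ sh : ℕ) : ℝ) := hm.1
  have h2 : Xs s * ((S' * 2 ^ sh : ℕ) : ℝ) ≤ ((E s).hi : ℝ) := hm.2
  have hlo' : ((tab s).lo : ℝ) * 2 ^ sh ≤ ((E s).lo : ℝ) := by exact_mod_cast hlo
  have hhi' : ((E s).hi : ℝ) ≤ ((tab s).hi : ℝ) * 2 ^ sh := by exact_mod_cast hhi
  push_cast at h1 h2
  have hl : ((tab s).lo : ℝ) ≤ Xs s * S' := by nlinarith
  have hu : Xs s * S' ≤ ((tab s).hi : ℝ) := by nlinarith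
  have e : Xs s - (((tab s).lo : ℝ) + (tab s).hi) / (2 * S') = (2 * (Xs s * S') - (((tab s).lo : ℝ) + (tab s).hi)) / (2 * S') := by
    field_simp
  rw [e, abs_div, abs_of_pos (by positivity : (0 : ℝ) < 2 * S'), div_le_div_iff_of_pos_right (by positivity), abs_le]
  constructor <;> linarith

/-- Gluing two consecutive bands of one pair. -/
theorem band_append {P : ℕ → Prop} {s0 n k : ℕ} (h1 : ∀ s, s0 ≤ s → s < s0 + n → P s)
    (h2 : ∀ s, s0 + n ≤ s → s < s0 + n + k → P s) : ∀ s, s0 ≤ s → s < s0 + (n + k) → P s :=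
  fun s hs hsk ↦ if h : s < s0 + n then h1 s hs h else h2 s (by omega) (by omega)

/-- The empty band. -/
theorem band_zero {P : ℕ → Prop} {s0 : ℕ} : ∀ s, s0 ≤ s → s < s0 + 0 → P s := fun _ h1 h2 ↦ absurd h2 (by omega)

/-! ## Assembly: the door's `hH` and `hsym` from the ten pairs -/

/-- ★ **The door's Hankel hypotheses from per-pair facts.**  If the claimed table is tag-symmetric, `X` is tag-symmetric, and every
pair `t ≤ t'` satisfies `|X t t' s − mid| ≤ rad` on `2 ≤ s ≤ 2D` (mid/rad of `tab` at scale `S'`), then `hH` holds for ALL pairs with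
`CinfCoeff.tabMid/tabRad`, and `tabRad` is tag-symmetric. -/
theorem hankel_of_pairs {S' D : ℕ} {Y : Fin 4 → Fin 4 → ℕ → ℝ} {tab : ℕ → ℕ → ℕ → MI}
    (htab : ∀ (t t' : Fin 4) (s : ℕ), tab t t' s = tab t' t s) (hY : ∀ (t t' : Fin 4) (s : ℕ), Y t t' s = Y t' t s)
    (h : ∀ (t t' : Fin 4), (t : ℕ) ≤ t' → ∀ s, 2 ≤ s → s < 2 + (2 * D - 1) →
      |Y t t' s - (((tab t t' s).lo : ℝ) + (tab t t' s).hi) / (2 * S')| ≤ (((tab t t' s).hi : ℝ) - (tab t t' s).lo) / (2 * S')) :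
    (∀ (t t' : Fin 4) (s : ℕ), 2 ≤ s → s ≤ 2 * D → |Y t t' s - tabMid S' tab D t t' s| ≤ tabRad S' tab D t t' s) ∧
      ∀ (t t' : Fin 4) (s : ℕ), tabRad S' tab D t t' s = tabRad S' tab D t' t s := by
  refine ⟨fun t t' s hs hsD ↦ ?_, fun t t' s ↦ ?_⟩
  · rw [tabMid, tabRad, if_pos hsD, if_pos hsD]
    by_cases hle : (t : ℕ) ≤ t'
    · exact h t t' hle s hs (by omega)
    · have h' := h t' t (by omega) s hs (by omega)
      rwa [hY t t', htab t t']
  · unfold tabRad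
    rw [htab t t']

end CinfHankelR

end Summit.RiemannHypothesis.RiemannHypothesis.Theorems.WeilFormatC
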